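import Mathlib
import HarnessLib
import Summits.ValiantsHypothesis.ValiantsHypothesis.Theorems.LacunarySymmetroidMatrixDescartesProductPlusOneRiccati
import Summits.ValiantsHypothesis.ValiantsHypothesis.Theorems.LacunarySymmetroidMatrixDescartesProductPlusOneLetterVariance

/-!
# ValiantsHypothesis / LacunarySymmetroid — crux `MatrixDescartes` (stmt-ValiantsHypothesis-18050, V1),
# LINE (A) «product_plus_one», floor `OneChangeFloorK3`: POINTWISE CHART FORMS — the row-wise twin of the sign-free window count

Every format `(m, K)`, support `d`, table `a`, coupling `l₀`; `R = eulerNumerator d a l₀` (unfolded), `P = ∏ f_j`, `F_j = f_j(t)`, letters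
`u_{jl} = a_{jl} t^{d_l}`, `e_l = d_l − d_{l₀}`, stripped Euler letter `N_j = Σ_l e_l u_{jl}`, log-Wronskian `W_j = W(f_j)(t) = F_j·Σ_l e_l² u_{jl} − N_j²`
(`W(g) = g·θ(θg) − (θg)²`, coupling-free).  At a zero `t` of `R` off the poles `Σ_j N_j/F_j = 0` (✓ `eval_eulerNumerator_eq_prod_mul_sum`) and
`t·R′(t)·P(t) = Σ_j W_j·∏_{i≠j} F_i²` (✓ `crossing_sign`), so for EVERY real `λ`:
  `t·R′(t)·P(t) = P(t)²·Σ_j (W_j − λ N_j F_j)/F_j²`,  `W_j − λ N_j F_j = F_j·Σ_l e_l(e_l − λ)u_{jl} − N_j²`  (`x^{−λ}·Σ_j Φ_j` is the level function).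
* ★ `eulerNumerator_roots_Icc_le_one_of_rowForms` — on a pole-free `[u,v] ⊂ (0,∞)`: if at every zero of `R` in `[u,v]` SOME `λ` makes every row
  form `F_j·Σ_l e_l(e_l − λ)u_{jl} − N_j²` nonpositive and one negative, `R` has AT MOST ONE zero in `[u,v]` (strict down-crossings;
  ✓ `euler_roots_Icc_le_one_of_down`) — the ROW-WISE twin of ✓ `…_of_reducedMoment_neg` (AB6, letter-wise, which drops `−Σ_j Φ_j²`).
* K = 3, bottom coupling (`p = d_1 − d_0 < q = d_2 − d_0`, `F = u0+u1+u2`, `N = p u1 + q u2`):  TOP form (`λ = q`) `Q = N² + p(q−p)·u1·F`,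
  BOTTOM form (`λ = p`) `B = N² − q(q−p)·u2·F`.  `topForm_pos_of_middle_agrees` (`u1·F ≥ 0` ⇒ `Q > 0`: every SWITCHED incoherent row is tame in
  the top chart at EVERY ratio — the new reading), `topForm_pos_of_lowerSigned` (`u0·u1 ≥ 0` ⇒ `Q > 0`, both branches:
  `4q·Q = p(2q u1 + (3q−p)u2)² + (q−p)²(4q−p)u2² + 4pq(q−p)u0u1`, ✓ `…LowerSignedCalculus` at K = 3), `bottomForm_pos_of_top_opposes`
  (`u2·F ≤ 0` ⇒ `B > 0`: every UNSWITCHED incoherent or coherent row), `bottomForm_nonneg_of_tame` (`q ≤ 4p`, `u0·u2 ≤ 0` ⇒ `B ≥ 0`: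
  `4p²·B = (2p²u1 + q(3p−q)u2)² + q(q−p)²(4p−q)u2² − 4p²q(q−p)u0u2`, ✓ `key_identity`'s threshold).  RESIDUAL agents, pointwise: top chart — only
  UNSWITCHED rows with `a_0a_1 < 0` (weak pullers, `N² < p(q−p)|u1F|`); bottom chart — only SWITCHED rows with `u2·F > 0` (hot risers, `N² < q(q−p)u2F`).
* ★ `eulerNumerator_roots_Icc_le_one_of_topChart` — K = 3, `d 0 < d 1 < d 2`, bottom coupling: on a pole-free window where every row is lower-signed
  (`a_{j0}a_{j1} ≥ 0`, both branches) or has its middle letter agreeing with its value (`a_{j1}·f_j(t) ≥ 0`: switched incoherent / two-change rows),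
  `R` has ≤ 1 zero.  New at ratio > 4: every window beyond the LAST incoherent zero of a one-change member, in any one-signed/coherent company.
* ★ `eulerNumerator_roots_Icc_le_one_of_bottomChart` — on a pole-free window where every row's value opposes its top letter (`a_{j2}·f_j(t) ≤ 0`:
  incoherent and coherent rows unswitched) or (`d_2 − d_0 ≤ 4(d_1 − d_0)` and `a_{j0}a_{j2} ≤ 0`), `R` has ≤ 1 zero.  New at ratio > 4: the window
  before the FIRST zero of a coherent + incoherent company.

HONEST FRAMING: local window counts and pointwise certificates; the residual cells (weak pullers against hot risers) are untouched; NOT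
`OneChangeFloorK3` / `stub_eulerBoundK3` / `stub_classRowK3` / `stub_polyLaw` / `MatrixDescartes` / B; `VP ≠ VNP` NOT proved.  No definitions, no named facts.
-/

set_option linter.dupNamespace false

namespace Summit.ValiantsHypothesis.ValiantsHypothesis.Theorems.LacunarySymmetroidMatrixDescartes

namespace ProductPlusOne

open Polynomial Finset
open scoped BigOperators

/-! ### §1 Algebra: the row-wise splitting of the crossing sign -/

/-- **Row-wise splitting.**  Nonzero values `F_j`, letters `N_j` with `Σ_j N_j/F_j = 0`, numbers `W_j` with `W_j ≤ λ N_j F_j` for all `j` and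
`<` for one `j`: then `Σ_j W_j·∏_{i≠j} F_i² < 0`. [this file's lemma] -/
theorem sum_wronskian_neg_of_rowForms {m : ℕ} (F N W : Fin m → ℝ) (hF : ∀ j, F j ≠ 0)
    (hsum : ∑ j, N j / F j = 0) (lam : ℝ) (hrow : ∀ j, W j ≤ lam * N j * F j) (hstrict : ∃ j, W j < lam * N j * F j) :
    ∑ j, W j * ∏ i ∈ Finset.univ.erase j, F i ^ 2 < 0 := by
  classical
  have hPpos : 0 < ∏ i, F i ^ 2 := Finset.prod_pos fun i _ => by have := hF i; positivity
  have key : ∀ j, W j * ∏ i ∈ Finset.univ.erase j, F i ^ 2 = (W j / F j ^ 2) * ∏ i, F i ^ 2 := by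
    intro j
    have h := Finset.mul_prod_erase Finset.univ (fun i => F i ^ 2) (Finset.mem_univ j)
    have hFj : F j ^ 2 ≠ 0 := pow_ne_zero 2 (hF j)
    rw [← h, ← mul_assoc, div_mul_cancel₀ _ hFj]
  simp_rw [key, ← Finset.sum_mul]
  refine mul_neg_of_neg_of_pos ?_ hPpos
  have hle : ∀ j ∈ (Finset.univ : Finset (Fin m)), W j / F j ^ 2 ≤ lam * N j * F j / F j ^ 2 :=
    fun j _ => div_le_div_of_nonneg_right (hrow j) (sq_nonneg _)
  obtain ⟨j₀, hj₀⟩ := hstrict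
  have hlt : W j₀ / F j₀ ^ 2 < lam * N j₀ * F j₀ / F j₀ ^ 2 :=
    div_lt_div_of_pos_right hj₀ (by have := hF j₀; positivity)
  have hzero : ∑ j, lam * N j * F j / F j ^ 2 = lam * ∑ j, N j / F j := by
    rw [Finset.mul_sum]
    exact Finset.sum_congr rfl fun j _ => by have hFj := hF j; field_simp
  calc ∑ j, W j / F j ^ 2 < ∑ j, lam * N j * F j / F j ^ 2 := Finset.sum_lt_sum hle ⟨j₀, Finset.mem_univ _, hlt⟩
    _ = 0 := by rw [hzero, hsum, mul_zero]

/-- The log-Wronskian form is shift-invariant and splits off a level: with `e_l = d_l − c`,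
`(Σu)(Σ d²u) − (Σ du)² − λ·(Σ e u)(Σ u) = (Σu)(Σ e(e−λ)u) − (Σ e u)²`. [folklore] -/
theorem wronskianForm_shift_level {K : ℕ} (d u : Fin K → ℝ) (c lam : ℝ) :
    (∑ l, u l) * (∑ l, d l ^ 2 * u l) - (∑ l, d l * u l) ^ 2 - lam * (∑ l, (d l - c) * u l) * (∑ l, u l)
      = (∑ l, u l) * (∑ l, (d l - c) * ((d l - c) - lam) * u l) - (∑ l, (d l - c) * u l) ^ 2 := by
  have e1 : ∑ l, (d l - c) * ((d l - c) - lam) * u l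
      = ∑ l, d l ^ 2 * u l - (2 * c + lam) * ∑ l, d l * u l + (c ^ 2 + c * lam) * ∑ l, u l := by
    rw [Finset.mul_sum, Finset.mul_sum, ← Finset.sum_sub_distrib, ← Finset.sum_add_distrib]
    exact Finset.sum_congr rfl fun l _ => by ring
  have e2 : ∑ l, (d l - c) * u l = ∑ l, d l * u l - c * ∑ l, u l := by
    rw [Finset.mul_sum, ← Finset.sum_sub_distrib]
    exact Finset.sum_congr rfl fun l _ => by ring
  rw [e1, e2]; ring

/-! ### §2 Evaluations of the row data -/

/-- The stripped Euler letter at `t`: `(X f′ − d_{l₀} f)(t) = Σ_l (d_l − d_{l₀})·(a_l t^{d_l})`. [folklore] -/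
theorem eval_euler_fewnomial_eq {K : ℕ} (d : Fin K → ℕ) (b : Fin K → ℝ) (l₀ : Fin K) (t : ℝ) :
    (X * derivative (∑ l, C (b l) * X ^ (d l) : ℝ[X]) - C ((d l₀ : ℕ) : ℝ) * ∑ l, C (b l) * X ^ (d l)).eval t
      = ∑ l, ((d l : ℝ) - d l₀) * (b l * t ^ (d l)) := by
  rw [euler_fewnomial, eval_fewnomial]
  exact Finset.sum_congr rfl fun l _ => by ring

/-- The log-Wronskian of a fewnomial at `t`: `W(f)(t) = (Σ_l u_l)(Σ_l d_l² u_l) − (Σ_l d_l u_l)²`, `u_l = a_l t^{d_l}`. [folklore] -/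
theorem eval_logWronskian_fewnomial_eq {K : ℕ} (d : Fin K → ℕ) (b : Fin K → ℝ) (t : ℝ) :
    ((∑ l, C (b l) * X ^ (d l) : ℝ[X]) * (X * derivative (X * derivative (∑ l, C (b l) * X ^ (d l) : ℝ[X])))
        - (X * derivative (∑ l, C (b l) * X ^ (d l) : ℝ[X])) ^ 2).eval t
      = (∑ l, b l * t ^ (d l)) * (∑ l, (d l : ℝ) ^ 2 * (b l * t ^ (d l))) - (∑ l, (d l : ℝ) * (b l * t ^ (d l))) ^ 2 := by
  rw [eval_sub, eval_mul, eval_pow, eval_fewnomial, eval_theta_fewnomial, eval_theta_theta_fewnomial]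
  have e1 : ∑ l, b l * (d l : ℝ) * (d l : ℝ) * t ^ (d l) = ∑ l, (d l : ℝ) ^ 2 * (b l * t ^ (d l)) :=
    Finset.sum_congr rfl fun l _ => by ring
  have e2 : ∑ l, b l * (d l : ℝ) * t ^ (d l) = ∑ l, (d l : ℝ) * (b l * t ^ (d l)) :=
    Finset.sum_congr rfl fun l _ => by ring
  rw [e1, e2]

/-! ### §3 The row-wise window count (every format, every coupling) -/

/-- ★ **THE ROW-WISE WINDOW COUNT** (every format `(m, K)`, support `d`, table `a`, coupling `l₀`; `R = eulerNumerator d a l₀` unfolded):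
on a pole-free `[u,v] ⊂ (0,∞)`, if at every zero `t ∈ [u,v]` of `R` there is a real `λ` with
`F_j(t)·Σ_l e_l(e_l − λ)·a_{jl}t^{d_l} ≤ N_j(t)²` for every row `j` (`e_l = d_l − d_{l₀}`, `N_j(t) = Σ_l e_l a_{jl}t^{d_l}`) and `<` for some
row, then `R` has AT MOST ONE zero in `[u,v]`. [this file's theorem] -/
theorem eulerNumerator_roots_Icc_le_one_of_rowForms {m K : ℕ} (d : Fin K → ℕ) (a : Fin m → Fin K → ℝ) (l₀ : Fin K)
    {u v : ℝ} (hu : 0 < u) (hf : ∀ t ∈ Set.Icc u v, ∀ j, (∑ l, C (a j l) * X ^ (d l) : ℝ[X]).eval t ≠ 0)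
    (hrow : ∀ t ∈ Set.Icc u v,
      (∑ j, (∑ l, C (a j l * ((d l : ℝ) - d l₀)) * X ^ (d l)) * ∏ i ∈ Finset.univ.erase j, (∑ l, C (a i l) * X ^ (d l))
          : ℝ[X]).eval t = 0 →
        ∃ lam : ℝ,
          (∀ j, (∑ l, a j l * t ^ (d l)) * (∑ l, ((d l : ℝ) - d l₀) * (((d l : ℝ) - d l₀) - lam) * (a j l * t ^ (d l)))
              ≤ (∑ l, ((d l : ℝ) - d l₀) * (a j l * t ^ (d l))) ^ 2) ∧
          (∃ j, (∑ l, a j l * t ^ (d l)) * (∑ l, ((d l : ℝ) - d l₀) * (((d l : ℝ) - d l₀) - lam) * (a j l * t ^ (d l)))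
              < (∑ l, ((d l : ℝ) - d l₀) * (a j l * t ^ (d l))) ^ 2)) :
    ((∑ j, (∑ l, C (a j l * ((d l : ℝ) - d l₀)) * X ^ (d l)) * ∏ i ∈ Finset.univ.erase j, (∑ l, C (a i l) * X ^ (d l))
        : ℝ[X]).roots.toFinset.filter (fun t => u ≤ t ∧ t ≤ v)).card ≤ 1 := by
  classical
  set f : Fin m → ℝ[X] := fun j => ∑ l, C (a j l) * X ^ (d l) with hfdef
  have hP : ∀ t ∈ Set.Icc u v, (∏ j, f j).eval t ≠ 0 := fun t ht => by
    rw [eval_prod]; exact Finset.prod_ne_zero_iff.2 fun j _ => hf t ht j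
  have hdown : ∀ t ∈ Set.Icc u v,
      (X * derivative (∏ j, f j) - C ((m : ℝ) * (d l₀ : ℝ)) * ∏ j, f j).eval t = 0 →
        (derivative (X * derivative (∏ j, f j) - C ((m : ℝ) * (d l₀ : ℝ)) * ∏ j, f j)).eval t * (∏ j, f j).eval t < 0 := by
    intro t ht hEt
    have ht0 : 0 < t := hu.trans_le ht.1
    have hft := hf t ht
    -- the zero in the line's shape
    have hRt : (∑ j, (∑ l, C (a j l * ((d l : ℝ) - d l₀)) * X ^ (d l)) * ∏ i ∈ Finset.univ.erase j,
        (∑ l, C (a i l) * X ^ (d l)) : ℝ[X]).eval t = 0 := by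
      rw [eulerNumerator_eq_general]; exact hEt
    obtain ⟨lam, hle, j₀, hlt⟩ := hrow t ht hRt
    -- row data at `t`
    set Fv : Fin m → ℝ := fun j => ∑ l, a j l * t ^ (d l) with hFv
    set Nv : Fin m → ℝ := fun j => ∑ l, ((d l : ℝ) - d l₀) * (a j l * t ^ (d l)) with hNv
    set Wv : Fin m → ℝ := fun j => (∑ l, a j l * t ^ (d l)) * (∑ l, (d l : ℝ) ^ 2 * (a j l * t ^ (d l)))
      - (∑ l, (d l : ℝ) * (a j l * t ^ (d l))) ^ 2 with hWv
    have hFf : ∀ j, (f j).eval t = Fv j := fun j => by simp only [hfdef, hFv]; exact eval_fewnomial d (a j) t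
    have hFv0 : ∀ j, Fv j ≠ 0 := fun j => by rw [← hFf j]; exact hft j
    -- `Σ_j N_j / F_j = 0`
    have hsum : ∑ j, Nv j / Fv j = 0 := by
      have h := eval_eulerNumerator_eq_prod_mul_sum d a l₀ hft
      rw [hRt] at h
      have hPt : (∏ j, (∑ l, C (a j l) * X ^ (d l) : ℝ[X]).eval t) ≠ 0 := Finset.prod_ne_zero_iff.2 fun j _ => hft j
      have hS := (mul_eq_zero.mp h.symm).resolve_left hPt
      rw [← hS]
      refine Finset.sum_congr rfl fun j _ => ?_
      rw [eval_euler_fewnomial_eq d (a j) l₀ t, ← hFf j]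
    -- the Wronskian form, shifted to the coupling, is `≤ λ N F` row by row
    have hWshift : ∀ j, Wv j - lam * Nv j * Fv j
        = Fv j * (∑ l, ((d l : ℝ) - d l₀) * (((d l : ℝ) - d l₀) - lam) * (a j l * t ^ (d l))) - Nv j ^ 2 :=
      fun j => wronskianForm_shift_level (fun l => (d l : ℝ)) (fun l => a j l * t ^ (d l)) (d l₀ : ℝ) lam
    have hrow' : ∀ j, Wv j ≤ lam * Nv j * Fv j := fun j => by
      have := hWshift j; have := hle j; linarith
    have hstrict' : ∃ j, Wv j < lam * Nv j * Fv j := ⟨j₀, by have := hWshift j₀; linarith⟩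
    have hneg := sum_wronskian_neg_of_rowForms Fv Nv Wv hFv0 hsum lam hrow' hstrict'
    -- bridge to `t · E′(t) · P(t)` via `crossing_sign`
    have hcs := crossing_sign f ((m : ℝ) * (d l₀ : ℝ)) t hEt
    have hW : ∀ j, ((f j * (X * derivative (X * derivative (f j))) - (X * derivative (f j)) ^ 2).eval t) = Wv j := by
      intro j; simp only [hfdef, hWv]; exact eval_logWronskian_fewnomial_eq d (a j) t
    have hrhs : ∑ j, ((f j * (X * derivative (X * derivative (f j))) - (X * derivative (f j)) ^ 2).eval t
        * ∏ i ∈ Finset.univ.erase j, ((f i).eval t) ^ 2) = ∑ j, Wv j * ∏ i ∈ Finset.univ.erase j, Fv i ^ 2 := by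
      refine Finset.sum_congr rfl fun j _ => ?_
      rw [hW j]
      congr 1
      exact Finset.prod_congr rfl fun i _ => by rw [hFf i]
    rw [hrhs] at hcs
    have hprod : t * ((derivative (X * derivative (∏ j, f j) - C ((m : ℝ) * (d l₀ : ℝ)) * ∏ j, f j)).eval t
        * (∏ j, f j).eval t) < 0 := by
      rw [← mul_assoc, hcs]; exact hneg
    exact neg_of_mul_neg_right hprod ht0.le
  have key := euler_roots_Icc_le_one_of_down f ((m : ℝ) * (d l₀ : ℝ)) hP hdown
  rw [eulerNumerator_eq_general]
  exact key

/-! ### §4 K = 3, bottom coupling: the two chart forms (pure algebra) -/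

/-- **TOP form, middle letter agreeing with the value** (`0 < p < q`, `F ≠ 0`, `(u1, u2) ≠ 0`, `u1·F ≥ 0`):
`F·(p(p−q)u1 + q(q−q)u2) < (p u1 + q u2)²`, i.e. `Q = N² + p(q−p)u1F > 0`. [this file's lemma] -/
theorem topForm_pos_of_middle_agrees (p q u1 u2 F : ℝ) (hp : 0 < p) (hpq : p < q) (hF : F ≠ 0)
    (hnd : u1 ≠ 0 ∨ u2 ≠ 0) (hu1F : 0 ≤ u1 * F) :
    F * (p * (p - q) * u1 + q * (q - q) * u2) < (p * u1 + q * u2) ^ 2 := by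
  have hq : 0 < q := hp.trans hpq
  rcases eq_or_ne u1 0 with h1 | h1
  · subst h1
    have h2 : u2 ≠ 0 := hnd.resolve_left (fun h => h rfl)
    have : 0 < (q * u2) ^ 2 := by positivity
    nlinarith
  · have hpos : 0 < u1 * F := lt_of_le_of_ne hu1F (Ne.symm (mul_ne_zero h1 hF))
    nlinarith [sq_nonneg (p * u1 + q * u2), mul_pos (mul_pos hp (sub_pos.2 hpq)) hpos]

/-- **TOP form, lower-signed row** (`0 < p < q`, `F = u0 + u1 + u2`, `(u1, u2) ≠ 0`, `u0·u1 ≥ 0`; both branches, top letter free):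
`Q > 0`, by the certificate `4q·Q = p(2q u1 + (3q−p)u2)² + (q−p)²(4q−p)u2² + 4pq(q−p)·u0u1`. [this file's lemma; ✓ `…LowerSignedCalculus` at K = 3] -/
theorem topForm_pos_of_lowerSigned (p q u0 u1 u2 : ℝ) (hp : 0 < p) (hpq : p < q)
    (hnd : u1 ≠ 0 ∨ u2 ≠ 0) (h01 : 0 ≤ u0 * u1) :
    (u0 + u1 + u2) * (p * (p - q) * u1 + q * (q - q) * u2) < (p * u1 + q * u2) ^ 2 := by
  have hq : 0 < q := hp.trans hpq
  have hqp : 0 < q - p := sub_pos.2 hpq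
  have cert : 4 * q * ((p * u1 + q * u2) ^ 2 - (u0 + u1 + u2) * (p * (p - q) * u1 + q * (q - q) * u2))
      = p * (2 * q * u1 + (3 * q - p) * u2) ^ 2 + (q - p) ^ 2 * (4 * q - p) * u2 ^ 2
        + 4 * p * q * (q - p) * (u0 * u1) := by ring
  have h3 : 0 ≤ 4 * p * q * (q - p) * (u0 * u1) := by positivity
  have hsum : 0 < p * (2 * q * u1 + (3 * q - p) * u2) ^ 2 + (q - p) ^ 2 * (4 * q - p) * u2 ^ 2 := by
    rcases eq_or_ne u2 0 with h2 | h2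
    · subst h2
      have h1 : 2 * q * u1 ≠ 0 := mul_ne_zero (by positivity) (hnd.resolve_right (fun h => h rfl))
      have : 0 < (2 * q * u1) ^ 2 := by positivity
      nlinarith
    · have : 0 < (q - p) ^ 2 * (4 * q - p) * u2 ^ 2 := by
        have h4 : 0 < 4 * q - p := by linarith
        positivity
      nlinarith [sq_nonneg (2 * q * u1 + (3 * q - p) * u2)]
  have h4 : 0 < 4 * q * ((p * u1 + q * u2) ^ 2 - (u0 + u1 + u2) * (p * (p - q) * u1 + q * (q - q) * u2)) := by
    rw [cert]; linarith
  have h5 := (mul_pos_iff_of_pos_left (by positivity : (0 : ℝ) < 4 * q)).mp h4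
  linarith

/-- **BOTTOM form, top letter opposing the value** (`0 < p < q`, `F ≠ 0`, `(u1, u2) ≠ 0`, `u2·F ≤ 0`):
`F·(p(p−p)u1 + q(q−p)u2) < (p u1 + q u2)²`, i.e. `B = N² − q(q−p)u2F > 0`. [this file's lemma] -/
theorem bottomForm_pos_of_top_opposes (p q u1 u2 F : ℝ) (hp : 0 < p) (hpq : p < q) (hF : F ≠ 0)
    (hnd : u1 ≠ 0 ∨ u2 ≠ 0) (hu2F : u2 * F ≤ 0) :
    F * (p * (p - p) * u1 + q * (q - p) * u2) < (p * u1 + q * u2) ^ 2 := by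
  have hq : 0 < q := hp.trans hpq
  rcases eq_or_ne u2 0 with h2 | h2
  · subst h2
    have h1 : u1 ≠ 0 := hnd.resolve_right (fun h => h rfl)
    have : 0 < (p * u1) ^ 2 := by positivity
    nlinarith
  · have hneg : u2 * F < 0 := lt_of_le_of_ne hu2F (mul_ne_zero h2 hF)
    nlinarith [sq_nonneg (p * u1 + q * u2), mul_pos hq (sub_pos.2 hpq)]

/-- **BOTTOM form in the tame window** (`0 < p`, `p ≤ q ≤ 4p`, `F = u0 + u1 + u2`, `u0·u2 ≤ 0`): `B ≥ 0`, by the certificate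
`4p²·B = (2p²u1 + q(3p−q)u2)² + q(q−p)²(4p−q)u2² − 4p²q(q−p)·u0u2` (the threshold `r(r−3)² − 4 = (r−1)²(r−4)` of ✓ `key_identity`).
[this file's lemma] -/
theorem bottomForm_nonneg_of_tame (p q u0 u1 u2 : ℝ) (hp : 0 < p) (hpq : p ≤ q) (hq4 : q ≤ 4 * p) (h02 : u0 * u2 ≤ 0) :
    (u0 + u1 + u2) * (p * (p - p) * u1 + q * (q - p) * u2) ≤ (p * u1 + q * u2) ^ 2 := by
  have hq : 0 < q := hp.trans_le hpq
  have cert : 4 * p ^ 2 * ((p * u1 + q * u2) ^ 2 - (u0 + u1 + u2) * (p * (p - p) * u1 + q * (q - p) * u2))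
      = (2 * p ^ 2 * u1 + q * (3 * p - q) * u2) ^ 2 + q * (q - p) ^ 2 * (4 * p - q) * u2 ^ 2
        - 4 * p ^ 2 * q * (q - p) * (u0 * u2) := by ring
  have h1 : 0 ≤ q * (q - p) ^ 2 * (4 * p - q) * u2 ^ 2 := by
    have : 0 ≤ 4 * p - q := by linarith
    positivity
  have h2 : 0 ≤ -(4 * p ^ 2 * q * (q - p) * (u0 * u2)) := by
    have : 0 ≤ 4 * p ^ 2 * q * (q - p) := by
      have : 0 ≤ q - p := by linarith
      positivity
    nlinarith
  have h3 : 0 ≤ 4 * p ^ 2 * ((p * u1 + q * u2) ^ 2 - (u0 + u1 + u2) * (p * (p - p) * u1 + q * (q - p) * u2)) := by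
    rw [cert]; nlinarith [sq_nonneg (2 * p ^ 2 * u1 + q * (3 * p - q) * u2)]
  have hp2 : 0 < 4 * p ^ 2 := by positivity
  have h4 := (mul_nonneg_iff_of_pos_left hp2).mp h3
  linarith

/-! ### §5 K = 3 windows in the line's currency -/

/-- `Fin 3` bookkeeping: the row form at `λ`, the stripped letter and the value, written in the three letters. [folklore] -/
theorem fin3_rowForm_eq (d : Fin 3 → ℕ) (b : Fin 3 → ℝ) (t lam : ℝ) :
    (∑ l, b l * t ^ (d l)) = b 0 * t ^ (d 0) + b 1 * t ^ (d 1) + b 2 * t ^ (d 2) ∧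
    (∑ l, ((d l : ℝ) - d 0) * (((d l : ℝ) - d 0) - lam) * (b l * t ^ (d l)))
      = ((d 1 : ℝ) - d 0) * (((d 1 : ℝ) - d 0) - lam) * (b 1 * t ^ (d 1))
        + ((d 2 : ℝ) - d 0) * (((d 2 : ℝ) - d 0) - lam) * (b 2 * t ^ (d 2)) ∧
    (∑ l, ((d l : ℝ) - d 0) * (b l * t ^ (d l)))
      = ((d 1 : ℝ) - d 0) * (b 1 * t ^ (d 1)) + ((d 2 : ℝ) - d 0) * (b 2 * t ^ (d 2)) := by
  refine ⟨?_, ?_, ?_⟩ <;> simp [Fin.sum_univ_three]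

/-- ★ **THE TOP-CHART WINDOW** (K = 3, `d 0 < d 1 < d 2`, bottom coupling): on a pole-free `[u,v] ⊂ (0,∞)` on which, at every point, every row
is lower-signed (`a_{j0}·a_{j1} ≥ 0`) or has its middle letter agreeing with its value (`a_{j1}·f_j(t) ≥ 0` — every SWITCHED incoherent row),
and some row is not a bottom monomial, `R = eulerNumerator d a 0` has AT MOST ONE zero in `[u,v]`.  Windows beyond the last zero of the
incoherent rows of a one-change member qualify, in any company of one-signed and coherent rows, at every ratio. [this file's theorem] -/
theorem eulerNumerator_roots_Icc_le_one_of_topChart {m : ℕ} (d : Fin 3 → ℕ) (h01 : d 0 < d 1) (h12 : d 1 < d 2)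
    (a : Fin m → Fin 3 → ℝ) {u v : ℝ} (hu : 0 < u)
    (hf : ∀ t ∈ Set.Icc u v, ∀ j, (∑ l, C (a j l) * X ^ (d l) : ℝ[X]).eval t ≠ 0)
    (hrows : ∀ t ∈ Set.Icc u v, ∀ j, 0 ≤ a j 0 * a j 1 ∨ 0 ≤ a j 1 * (∑ l, C (a j l) * X ^ (d l) : ℝ[X]).eval t)
    (hnd : ∃ j, a j 1 ≠ 0 ∨ a j 2 ≠ 0) :
    ((∑ j, (∑ l, C (a j l * ((d l : ℝ) - d 0)) * X ^ (d l)) * ∏ i ∈ Finset.univ.erase j, (∑ l, C (a i l) * X ^ (d l))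
        : ℝ[X]).roots.toFinset.filter (fun t => u ≤ t ∧ t ≤ v)).card ≤ 1 := by
  have hp : (0 : ℝ) < (d 1 : ℝ) - d 0 := by have := (Nat.cast_lt (α := ℝ)).2 h01; linarith
  have hpq : ((d 1 : ℝ) - d 0) < (d 2 : ℝ) - d 0 := by have := (Nat.cast_lt (α := ℝ)).2 h12; linarith
  -- every non-monomial row has a POSITIVE top form at every point of the window
  have hpos : ∀ t ∈ Set.Icc u v, ∀ j, (a j 1 ≠ 0 ∨ a j 2 ≠ 0) →
      (a j 0 * t ^ (d 0) + a j 1 * t ^ (d 1) + a j 2 * t ^ (d 2))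
          * (((d 1 : ℝ) - d 0) * (((d 1 : ℝ) - d 0) - ((d 2 : ℝ) - d 0)) * (a j 1 * t ^ (d 1))
            + ((d 2 : ℝ) - d 0) * (((d 2 : ℝ) - d 0) - ((d 2 : ℝ) - d 0)) * (a j 2 * t ^ (d 2)))
        < (((d 1 : ℝ) - d 0) * (a j 1 * t ^ (d 1)) + ((d 2 : ℝ) - d 0) * (a j 2 * t ^ (d 2))) ^ 2 := by
    intro t ht j hj
    have ht0 : 0 < t := hu.trans_le ht.1
    have e0 := (fin3_rowForm_eq d (a j) t 0).1
    have hFj : a j 0 * t ^ (d 0) + a j 1 * t ^ (d 1) + a j 2 * t ^ (d 2) ≠ 0 := by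
      rw [← e0, ← eval_fewnomial]; exact hf t ht j
    have hnd' : a j 1 * t ^ (d 1) ≠ 0 ∨ a j 2 * t ^ (d 2) ≠ 0 := by
      rcases hj with h | h
      · exact Or.inl (mul_ne_zero h (pow_ne_zero _ ht0.ne'))
      · exact Or.inr (mul_ne_zero h (pow_ne_zero _ ht0.ne'))
    rcases hrows t ht j with hls | hmid
    · have h01' : 0 ≤ (a j 0 * t ^ (d 0)) * (a j 1 * t ^ (d 1)) := by
        have : (a j 0 * t ^ (d 0)) * (a j 1 * t ^ (d 1)) = (a j 0 * a j 1) * (t ^ (d 0) * t ^ (d 1)) := by ring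
        rw [this]; positivity
      exact topForm_pos_of_lowerSigned _ _ _ _ _ hp hpq hnd' h01'
    · have hu1F : 0 ≤ (a j 1 * t ^ (d 1)) * (a j 0 * t ^ (d 0) + a j 1 * t ^ (d 1) + a j 2 * t ^ (d 2)) := by
        rw [← e0, ← eval_fewnomial]
        have : a j 1 * t ^ (d 1) * (∑ l, C (a j l) * X ^ (d l) : ℝ[X]).eval t
            = t ^ (d 1) * (a j 1 * (∑ l, C (a j l) * X ^ (d l) : ℝ[X]).eval t) := by ring
        rw [this]; positivity
      exact topForm_pos_of_middle_agrees _ _ _ _ _ hp hpq hFj hnd' hu1F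
  refine eulerNumerator_roots_Icc_le_one_of_rowForms d a 0 hu hf fun t ht _ => ⟨(d 2 : ℝ) - d 0, ?_, ?_⟩
  · intro j
    obtain ⟨e0, e1, e2⟩ := fin3_rowForm_eq d (a j) t ((d 2 : ℝ) - d 0)
    rw [e0, e1, e2]
    by_cases hdeg : a j 1 = 0 ∧ a j 2 = 0
    · rw [hdeg.1, hdeg.2]; nlinarith
    · exact (hpos t ht j (not_and_or.mp hdeg)).le
  · obtain ⟨j, hj⟩ := hnd
    refine ⟨j, ?_⟩
    obtain ⟨e0, e1, e2⟩ := fin3_rowForm_eq d (a j) t ((d 2 : ℝ) - d 0)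
    rw [e0, e1, e2]
    exact hpos t ht j hj

/-- ★ **THE BOTTOM-CHART WINDOW** (K = 3, `d 0 < d 1 < d 2`, bottom coupling): on a pole-free `[u,v] ⊂ (0,∞)` on which, at every point, every
row's value opposes its top letter (`a_{j2}·f_j(t) ≤ 0` — every UNSWITCHED incoherent or coherent row), or the ratio is tame and the row has no
dip (`d 2 − d 0 ≤ 4·(d 1 − d 0)`, `a_{j0}·a_{j2} ≤ 0`), and some row is not a bottom monomial whose value opposes its top letter throughout,
`R = eulerNumerator d a 0` has AT MOST ONE zero in `[u,v]`.  The window before the first zero of a coherent + incoherent company qualifies at every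
ratio. [this file's theorem] -/
theorem eulerNumerator_roots_Icc_le_one_of_bottomChart {m : ℕ} (d : Fin 3 → ℕ) (h01 : d 0 < d 1) (h12 : d 1 < d 2)
    (a : Fin m → Fin 3 → ℝ) {u v : ℝ} (hu : 0 < u)
    (hf : ∀ t ∈ Set.Icc u v, ∀ j, (∑ l, C (a j l) * X ^ (d l) : ℝ[X]).eval t ≠ 0)
    (hrows : ∀ t ∈ Set.Icc u v, ∀ j, a j 2 * (∑ l, C (a j l) * X ^ (d l) : ℝ[X]).eval t ≤ 0
      ∨ (d 2 - d 0 ≤ 4 * (d 1 - d 0) ∧ a j 0 * a j 2 ≤ 0))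
    (hnd : ∃ j, (a j 1 ≠ 0 ∨ a j 2 ≠ 0) ∧ ∀ t ∈ Set.Icc u v, a j 2 * (∑ l, C (a j l) * X ^ (d l) : ℝ[X]).eval t ≤ 0) :
    ((∑ j, (∑ l, C (a j l * ((d l : ℝ) - d 0)) * X ^ (d l)) * ∏ i ∈ Finset.univ.erase j, (∑ l, C (a i l) * X ^ (d l))
        : ℝ[X]).roots.toFinset.filter (fun t => u ≤ t ∧ t ≤ v)).card ≤ 1 := by
  have hp : (0 : ℝ) < (d 1 : ℝ) - d 0 := by have := (Nat.cast_lt (α := ℝ)).2 h01; linarith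
  have hpq : ((d 1 : ℝ) - d 0) < (d 2 : ℝ) - d 0 := by have := (Nat.cast_lt (α := ℝ)).2 h12; linarith
  -- the top-opposing rows
  have hopp : ∀ t ∈ Set.Icc u v, ∀ j, a j 2 * (∑ l, C (a j l) * X ^ (d l) : ℝ[X]).eval t ≤ 0 → (a j 1 ≠ 0 ∨ a j 2 ≠ 0) →
      (a j 0 * t ^ (d 0) + a j 1 * t ^ (d 1) + a j 2 * t ^ (d 2))
          * (((d 1 : ℝ) - d 0) * (((d 1 : ℝ) - d 0) - ((d 1 : ℝ) - d 0)) * (a j 1 * t ^ (d 1))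
            + ((d 2 : ℝ) - d 0) * (((d 2 : ℝ) - d 0) - ((d 1 : ℝ) - d 0)) * (a j 2 * t ^ (d 2)))
        < (((d 1 : ℝ) - d 0) * (a j 1 * t ^ (d 1)) + ((d 2 : ℝ) - d 0) * (a j 2 * t ^ (d 2))) ^ 2 := by
    intro t ht j hle hj
    have ht0 : 0 < t := hu.trans_le ht.1
    have e0 := (fin3_rowForm_eq d (a j) t 0).1
    have hFj : a j 0 * t ^ (d 0) + a j 1 * t ^ (d 1) + a j 2 * t ^ (d 2) ≠ 0 := by
      rw [← e0, ← eval_fewnomial]; exact hf t ht j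
    have hnd' : a j 1 * t ^ (d 1) ≠ 0 ∨ a j 2 * t ^ (d 2) ≠ 0 := by
      rcases hj with h | h
      · exact Or.inl (mul_ne_zero h (pow_ne_zero _ ht0.ne'))
      · exact Or.inr (mul_ne_zero h (pow_ne_zero _ ht0.ne'))
    have hu2F : (a j 2 * t ^ (d 2)) * (a j 0 * t ^ (d 0) + a j 1 * t ^ (d 1) + a j 2 * t ^ (d 2)) ≤ 0 := by
      rw [← e0, ← eval_fewnomial]
      have : a j 2 * t ^ (d 2) * (∑ l, C (a j l) * X ^ (d l) : ℝ[X]).eval t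
          = t ^ (d 2) * (a j 2 * (∑ l, C (a j l) * X ^ (d l) : ℝ[X]).eval t) := by ring
      rw [this]
      exact mul_nonpos_of_nonneg_of_nonpos (pow_pos ht0 _).le hle
    exact bottomForm_pos_of_top_opposes _ _ _ _ _ hp hpq hFj hnd' hu2F
  refine eulerNumerator_roots_Icc_le_one_of_rowForms d a 0 hu hf fun t ht _ => ⟨(d 1 : ℝ) - d 0, ?_, ?_⟩
  · intro j
    have ht0 : 0 < t := hu.trans_le ht.1
    obtain ⟨e0, e1, e2⟩ := fin3_rowForm_eq d (a j) t ((d 1 : ℝ) - d 0)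
    rw [e0, e1, e2]
    by_cases hdeg : a j 1 = 0 ∧ a j 2 = 0
    · rw [hdeg.1, hdeg.2]; nlinarith
    have hj : a j 1 ≠ 0 ∨ a j 2 ≠ 0 := not_and_or.mp hdeg
    rcases hrows t ht j with hle | ⟨hq4, h02⟩
    · exact (hopp t ht j hle hj).le
    · have hq4' : ((d 2 : ℝ) - d 0) ≤ 4 * ((d 1 : ℝ) - d 0) := by
        have h : ((d 2 - d 0 : ℕ) : ℝ) ≤ ((4 * (d 1 - d 0) : ℕ) : ℝ) := (Nat.cast_le (α := ℝ)).2 hq4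
        rw [Nat.cast_sub (by omega), Nat.cast_mul, Nat.cast_sub (by omega)] at h
        simpa using h
      have h02' : (a j 0 * t ^ (d 0)) * (a j 2 * t ^ (d 2)) ≤ 0 := by
        have : (a j 0 * t ^ (d 0)) * (a j 2 * t ^ (d 2)) = (a j 0 * a j 2) * (t ^ (d 0) * t ^ (d 2)) := by ring
        rw [this]
        exact mul_nonpos_of_nonpos_of_nonneg h02 (by positivity)
      exact bottomForm_nonneg_of_tame _ _ _ _ _ hp hpq.le hq4' h02'
  · obtain ⟨j, hj, hjopp⟩ := hnd
    refine ⟨j, ?_⟩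
    obtain ⟨e0, e1, e2⟩ := fin3_rowForm_eq d (a j) t ((d 1 : ℝ) - d 0)
    rw [e0, e1, e2]
    exact hopp t ht j (hjopp t ht) hj

end ProductPlusOne

end Summit.ValiantsHypothesis.ValiantsHypothesis.Theorems.LacunarySymmetroidMatrixDescartes
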